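import Literature.Computability.Complexity.TVSelfCorrectParams
import Literature.Computability.Complexity.UniformDerandomizationSelectByTesting
import Literature.Computability.Complexity.PRGDerandomization
import HarnessLib

/-!
# Self-correction of Trevisan–Vadhan's `F` from an APPROXIMATE description (IW98 Def. 5 in the
# vocabulary of `approxCircuits`)

Literature / complexity — derandomization (Case 2 of IW98 in TV07 form), the last counting file of the
random self-reduction of `F` (`TVSelfCorrect.lean` → `TVSelfCorrectMajority.lean` →
`TVSelfCorrectParams.lean`), joined to the construction problems of the uniform pipeline
(`UniformDerandomizationSelectByTesting.lean`: `IWUniform.approxCircuits Ev f ρ n = {d | Pr_x[Ev ⟨d,x⟩ = [f x]] ≥ 1 − ρ n}`,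
what IW98 Lemma 14/18 deliver; `IWUniform.Bootstrap.circuitsFor Ev f`, what Lemma 16 consumes). For a
description `d` the corrected function reads the Boolean oracle `y ↦ (Ev ⟨d, y⟩ = 1)`:

* `QBFUniv.descFn Ev d`, `QBFUniv.badWords Ev d n i` (the words of length `h n i` on which `Ev ⟨d,·⟩`
  is not `[F ·]`), `QBFUniv.mem_badWords_of_ne`;
* `QBFUniv.card_badWords_le_of_mem_approx` — `d ∈ approxCircuits Ev FB ρ (h n i)` gives
  `#badWords ≤ ρ (h n i) · 2^{h n i}`, and `QBFUniv.rho_bound_of_mem_approx` — with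
  `ρ (h n i) ≤ 1 / (64 · blk n · (Dn n + 1)²)` (the constant cast from `ℕ`) the hypothesis `hρ` of
  `TVSelfCorrectParams`;
* **`QBFUniv.card_majCorrected_ne_le_div_of_mem_approx`** — for such `d`, the `8a`-fold majority of
  corrected trials of `descFn Ev d` differs from `F` somewhere on `{0,1}^{h n i}` on at most a `1/a`
  fraction of the coin tuples: `C^{F,1−ρ} → C^F` for Trevisan–Vadhan's `F`, as counting.

Everything is proved; definitions are plain (no named facts).

## References

* [ImpagliazzoWigderson2001] R. Impagliazzo, A. Wigderson, JCSS 63 (2001), §2.2 Defs. 3–5.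
* [TrevisanVadhan2007] L. Trevisan, S. Vadhan, Comput. Complexity 16 (2007), Lemma 3.5, Thm. 4.3 (proof).
-/

noncomputable section

namespace Literature.Computability.Complexity

namespace QBFUniv

open Finset Literature.InformationTheory.Coding PolySelfCorrect IWUniform

open scoped Classical

variable {n i : ℕ}

/-- The Boolean function read off a description through the evaluator. [folklore] -/
def descFn (Ev : List Bool → List Bool) (d : List Bool) : List Bool → Bool := fun y => decide (Ev (boolPair d y) = [true])

/-- **The bad words** of a description at length `h n i`: those where `Ev ⟨d, ·⟩ ≠ [F ·]`. [folklore] -/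
def badWords (Ev : List Bool → List Bool) (d : List Bool) (n i : ℕ) : Finset (List Bool) :=
  (univ.filter fun v : Fin (h n i) → Bool => Ev (boolPair d (List.ofFn v)) ≠ [FB (List.ofFn v)]).image List.ofFn

/-- Where the read-off function differs from `F`, the word is bad. [folklore] -/
theorem mem_badWords_of_ne (Ev : List Bool → List Bool) (d : List Bool) {w : List Bool} (hw : w.length = h n i)
    (hne : descFn Ev d w ≠ FB w) : w ∈ badWords Ev d n i := by
  rw [badWords, mem_image]
  have e : List.ofFn (fun j : Fin (h n i) => w.get (Fin.cast hw.symm j)) = w :=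
    List.ext_getElem (by simp [hw]) fun k h1 h2 => by simp
  refine ⟨fun j => w.get (Fin.cast hw.symm j), ?_, e⟩
  simp only [mem_filter, mem_univ, true_and]
  rw [e]
  intro hEq
  apply hne
  rw [descFn, hEq]
  cases FB w <;> decide

/-- The number of bad words is the number of bad bit vectors. [folklore] -/
theorem card_badWords (Ev : List Bool → List Bool) (d : List Bool) (n i : ℕ) :
    #(badWords Ev d n i) = #(univ.filter fun v : Fin (h n i) → Bool => Ev (boolPair d (List.ofFn v)) ≠ [FB (List.ofFn v)]) :=
  card_image_of_injective _ List.ofFn_injective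

/-- **An approximate description has few bad words**: `#badWords ≤ ρ · 2^{h n i}`.
[cite: ImpagliazzoWigderson2001, Def. 3] -/
theorem card_badWords_le_of_mem_approx {Ev : List Bool → List Bool} {d : List Bool} {ρ : ℕ → ℝ}
    (hd : d ∈ approxCircuits Ev FB ρ (h n i)) :
    (#(badWords Ev d n i) : ℝ) ≤ ρ (h n i) * 2 ^ h n i := by
  have e : #(badWords Ev d n i) = #(univ.filter fun v : Fin (h n i) → Bool => List.ofFn v ∈ Select.errSet Ev FB d) := by
    rw [card_badWords]
    congr 1
    exact filter_congr fun v _ => by simp [Select.errSet]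
  rw [Select.mem_approxCircuits_iff_errProb, Select.errProb,
    uniformProb_eq_card_filter_ofFn (h n i) (inst := fun v => Classical.propDecidable _), div_le_iff₀ (by positivity)] at hd
  rw [e]
  exact hd

/-- With `ρ (h n i) ≤ 1/(64 · blk n · (Dn n + 1)²)`, the hypothesis `hρ` of `TVSelfCorrectParams`.
[folklore] -/
theorem rho_bound_of_mem_approx {Ev : List Bool → List Bool} {d : List Bool} {ρ : ℕ → ℝ}
    (hd : d ∈ approxCircuits Ev FB ρ (h n i)) (hρ : ρ (h n i) ≤ 1 / ((64 * blk n * (Dn n + 1) ^ 2 : ℕ) : ℝ)) :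
    64 * blk n * (Dn n + 1) ^ 2 * #(badWords Ev d n i) ≤ 2 ^ h n i := by
  have h1 := card_badWords_le_of_mem_approx hd
  have hcn : 0 < 64 * blk n * (Dn n + 1) ^ 2 := by have := blk_pos n; positivity
  have hc : (0 : ℝ) < ((64 * blk n * (Dn n + 1) ^ 2 : ℕ) : ℝ) := by exact_mod_cast hcn
  have h2 : (#(badWords Ev d n i) : ℝ) ≤ 1 / ((64 * blk n * (Dn n + 1) ^ 2 : ℕ) : ℝ) * 2 ^ h n i :=
    h1.trans (mul_le_mul_of_nonneg_right hρ (by positivity))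
  rw [one_div, ← div_eq_inv_mul, le_div_iff₀ hc] at h2
  have h3 : ((64 * blk n * (Dn n + 1) ^ 2 * #(badWords Ev d n i) : ℕ) : ℝ) ≤ ((2 ^ h n i : ℕ) : ℝ) := by
    rw [Nat.cast_mul, Nat.cast_pow, Nat.cast_ofNat]
    linarith
  exact_mod_cast h3

/-- **`C^{F,1−ρ} → C^F` for Trevisan–Vadhan's `F`, as counting.** For a description `d` that is
`ρ`-approximately correct at length `h n i` with `ρ (h n i) ≤ 1/(64 · blk n · (Dn n + 1)²)`, the
`8a`-fold majority of corrected trials of `descFn Ev d` differs from `F` somewhere on `{0,1}^{h n i}` on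
at most a `1/a` fraction of the coin tuples. [cite: ImpagliazzoWigderson2001, Defs. 4–5]
[cite: TrevisanVadhan2007, Lemma 3.5] -/
theorem card_majCorrected_ne_le_div_of_mem_approx (hi : i ≤ mlen n) {Ev : List Bool → List Bool} {d : List Bool}
    {ρ : ℕ → ℝ} (hd : d ∈ approxCircuits Ev FB ρ (h n i)) (hρ : ρ (h n i) ≤ 1 / ((64 * blk n * (Dn n + 1) ^ 2 : ℕ) : ℝ))
    {a : ℕ} (ha : 1 ≤ a) :
    (#(univ.filter fun cs : Fin (trialsOf a) → Trial n i (linesOf n) =>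
        ∃ w : List Bool, w.length = h n i ∧ majCorrected (descFn Ev d) n cs w ≠ FB w) : ℝ) ≤
      Fintype.card (Fin (trialsOf a) → Trial n i (linesOf n)) / a :=
  card_majCorrected_ne_le_div hi (descFn Ev d) (badWords Ev d n i) (fun _ hw hne => mem_badWords_of_ne Ev d hw hne)
    (rho_bound_of_mem_approx hd hρ) ha

end QBFUniv

end Literature.Computability.Complexity

end
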